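import Literature.NumberTheory.GaloisRepresentations.ConeVanishing
import HarnessLib

/-!
# `NearlyOrdinaryPresentation` from a bound on the cone `H²`

Topic `Literature/NumberTheory/GaloisRepresentations`.  The assembly of the cone formulation of
Böckle's relation count for the universal nearly ordinary deformation ring `R_𝒟`
(Thm. 7.6 with Cor. 5.3): the record `NearlyOrdinaryPresentation` holds for `𝓡` as soon as,
for every minimal cotangent presentation `Θ : 𝒪⟦T₁, …, T_h⟧ ↠ R_𝒟` (`h = dim t_{R_𝒟}`) and
every exponent `n ≥ 2` with `J ∩ 𝔪ⁿ ⊆ 𝔪J`, the cone cohomology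
`ConeH2 = H²(cone(C•(G_{F,S}, ad ρ̄) → ⊕_{v∣p} C•(Γ_v, ad ρ̄/𝔟_v)))` (`ConeCocycles.lean`) is
finite-dimensional over `κ = 𝒪⟦T⟧/𝔪` with `dim ConeH2 + 1 + [F:ℚ] ≤ h`
(`nearlyOrdinaryPresentation_of_coneH2`).  The deformation-theoretic content — the cone
obstruction map is linear and its zeros split the pushed-out small extensions — is
`ConeCochainOfFunctional.lean` + `ConeVanishing.lean`; the degenerate functional `u = 0` is
treated here directly (`exists_coneLifts_zero`: `q_0 : B_0 ≅ R/𝔪ⁿ`).  What remains for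
`NearlyOrdinaryPresentation_holds` is the DIMENSION COUNT `dim ConeH2 = h − 1 − [F:ℚ]`
(Tate's global and local Euler characteristic formulae and the end of the Poitou–Tate
sequence; Böckle 2007, §§4–5).  Everything here is proved; no named facts.

## References

* G. Böckle, *Presentations of universal deformation rings*, LMS LNS 320 (2007), Thm. 7.6,
  Cor. 5.3. [cite: Bockle2007Presentations, Theorem 7.6]
* B. Mazur, *Deforming Galois representations*, MSRI Publ. 16 (1989), §1.6 Prop. 2.
  [cite: Mazur1989Deforming, §1.6 Prop. 2]
-/

noncomputable section

open scoped NumberField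
open Field IsDedekindDomain IsLocalRing Topology

namespace Literature.NumberTheory.GaloisRepresentations

namespace NearlyOrdinaryPresentationCA

open LiftingObstruction

/-! ## 1. The degenerate functional `u = 0`: `q_0` is an isomorphism -/

section Zero

variable {F : Type} [Field F] [NumberField F] {p : ℕ} {𝒪 : Type} [CommRing 𝒪] [IsLocalRing 𝒪]
  {k : Type} [Field k] [Algebra 𝒪 k] {𝒟 : NearlyOrdinaryDatum F p 𝒪 k}
  (𝓡 : NearlyOrdinaryDeformationRing.{0} 𝒟)
  {m : ℕ} (Θ : MvPowerSeries (Fin m) 𝒪 →ₐ[𝒪] 𝓡.R) (hΘ : Function.Surjective Θ)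
  (n : ℕ)
  (u : Module.Dual (MvPowerSeries (Fin m) 𝒪 ⧸ maximalIdeal (MvPowerSeries (Fin m) 𝒪))
    (↥(RingHom.ker Θ) ⧸ (maximalIdeal (MvPowerSeries (Fin m) 𝒪) •
      (⊤ : Submodule (MvPowerSeries (Fin m) 𝒪) ↥(RingHom.ker Θ)))))
  (hu : u = 0)

include hu in
/-- For `u = 0`, `q_0 : B_0 → R/𝔪ⁿ` is injective (`J_0 = J`). [folklore] -/
theorem quRaw_zero_injective : Function.Injective (quRaw Θ hΘ u n) := by
  subst hu
  intro x y hxy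
  obtain ⟨x, rfl⟩ := Ideal.Quotient.mk_surjective x
  obtain ⟨y, rfl⟩ := Ideal.Quotient.mk_surjective y
  rw [← sub_eq_zero, ← map_sub, ← map_sub, quRaw_mk_eq_zero_iff] at hxy
  rw [← sub_eq_zero, ← map_sub, Ideal.Quotient.eq_zero_iff_mem]
  obtain ⟨j, hj, z, hz, hjz⟩ := Submodule.mem_sup.mp hxy
  rw [← hjz]
  refine Ideal.add_mem _ (Ideal.mem_sup_left ?_) (Ideal.mem_sup_right hz)
  exact (Literature.RingTheory.CompleteLocalRings.mem_pushoutIdeal_iff (RingHom.ker Θ) 0 ⟨j, hj⟩).mpr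
    (LinearMap.zero_apply _)

/-- For `u = 0`, `q_0 : B_0 ≃ R/𝔪ⁿ`. [folklore] -/
def quZeroEquiv : (MvPowerSeries (Fin m) 𝒪 ⧸ pushoutTruncIdeal Θ u n) ≃+* 𝓡.R ⧸ maximalIdeal 𝓡.R ^ n :=
  RingEquiv.ofBijective (quRaw Θ hΘ u n) ⟨quRaw_zero_injective 𝓡 Θ hΘ n u hu, quRaw_surjective Θ hΘ u n⟩

/-- The inverse `q_0⁻¹ : R/𝔪ⁿ → B_0` as a ring homomorphism. [folklore] -/
def quZeroInv : (𝓡.R ⧸ maximalIdeal 𝓡.R ^ n) →+* (MvPowerSeries (Fin m) 𝒪 ⧸ pushoutTruncIdeal Θ u n) :=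
  (quZeroEquiv 𝓡 Θ hΘ n u hu).symm.toRingHom

/-- `q_0 ∘ q_0⁻¹ = id`. [folklore] -/
@[simp] theorem quHom_quZeroInv (x : 𝓡.R ⧸ maximalIdeal 𝓡.R ^ n) :
    quHom 𝓡 Θ hΘ n u (quZeroInv 𝓡 Θ hΘ n u hu x) = x := by
  change quZeroEquiv 𝓡 Θ hΘ n u hu ((quZeroEquiv 𝓡 Θ hΘ n u hu).symm x) = x
  exact RingEquiv.apply_symm_apply _ x

/-- `q_0 ∘ q_0⁻¹ = id` on `GL₂`, along any homomorphism. [folklore] -/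
theorem map_quHom_comp_map_quZeroInv {G : Type*} [Group G]
    (ρ : G →* GL (Fin 2) (𝓡.R ⧸ maximalIdeal 𝓡.R ^ n)) (σ : G) :
    Matrix.GeneralLinearGroup.map (quHom 𝓡 Θ hΘ n u)
      (((Matrix.GeneralLinearGroup.map (quZeroInv 𝓡 Θ hΘ n u hu)).comp ρ) σ) = ρ σ := by
  refine Units.ext (Matrix.ext fun i j => ?_)
  change quHom 𝓡 Θ hΘ n u (quZeroInv 𝓡 Θ hΘ n u hu (ρ σ i j)) = ρ σ i j
  exact quHom_quZeroInv 𝓡 Θ hΘ n u hu _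

/-- `q_0⁻¹` on `GL₂` (as a section). [folklore] -/
theorem map_quHom_map_quZeroInv (g : GL (Fin 2) (𝓡.R ⧸ maximalIdeal 𝓡.R ^ n)) :
    Matrix.GeneralLinearGroup.map (quHom 𝓡 Θ hΘ n u)
      (Matrix.GeneralLinearGroup.map (quZeroInv 𝓡 Θ hΘ n u hu) g) = g := by
  refine Units.ext (Matrix.ext fun i j => ?_)
  change quHom 𝓡 Θ hΘ n u (quZeroInv 𝓡 Θ hΘ n u hu (g i j)) = g i j
  exact quHom_quZeroInv 𝓡 Θ hΘ n u hu _

/-- Transport along the injective `GL₂(q_0⁻¹)` does not change kernels. [folklore] -/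
theorem ker_comp_map_quZeroInv {G : Type*} [Group G]
    (ρ : G →* GL (Fin 2) (𝓡.R ⧸ maximalIdeal 𝓡.R ^ n)) :
    ((Matrix.GeneralLinearGroup.map (quZeroInv 𝓡 Θ hΘ n u hu)).comp ρ).ker = ρ.ker := by
  ext σ
  rw [MonoidHom.mem_ker, MonoidHom.mem_ker]
  constructor
  · intro h
    have h' := map_quHom_comp_map_quZeroInv 𝓡 Θ hΘ n u hu ρ σ
    rw [h, map_one] at h'
    exact h'.symm
  · intro h
    rw [MonoidHom.comp_apply, h, map_one]

/-- The local data over `B_0` at `v ∣ p`: transported local representation, frame and section;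
the difference cochain vanishes. [cite: Bockle2007Presentations, Theorem 7.6] -/
theorem exists_coneLocalLifts_zero (v : HeightOneSpectrum (𝓞 F)) (hv : (p : 𝓞 F) ∈ v.asIdeal) :
    ∃ (P : GL (Fin 2) (MvPowerSeries (Fin m) 𝒪 ⧸ pushoutTruncIdeal Θ u n))
      (_ : Matrix.GeneralLinearGroup.map (quHom 𝓡 Θ hΘ n u) P = 𝓡.noFrameModPow v n)
      (s' : GL (Fin 2) (𝓡.R ⧸ maximalIdeal 𝓡.R ^ n) →
        GL (Fin 2) (MvPowerSeries (Fin m) 𝒪 ⧸ pushoutTruncIdeal Θ u n))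
      (_ : ∀ g, Matrix.GeneralLinearGroup.map (quHom 𝓡 Θ hΘ n u) (s' g) = g)
      (ρv : absoluteGaloisGroup (v.adicCompletion F) →*
        GL (Fin 2) (MvPowerSeries (Fin m) 𝒪 ⧸ pushoutTruncIdeal Θ u n))
      (e : absoluteGaloisGroup (v.adicCompletion F) →
        Matrix (Fin 2) (Fin 2) (MvPowerSeries (Fin m) 𝒪 ⧸ pushoutTruncIdeal Θ u n))
      (X : Matrix (Fin 2) (Fin 2) (MvPowerSeries (Fin m) 𝒪 ⧸ pushoutTruncIdeal Θ u n)),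
      (∀ σ, Matrix.GeneralLinearGroup.map (quHom 𝓡 Θ hΘ n u) (ρv σ) = 𝓡.localModPow v n σ) ∧
      (∀ σ, (ρv σ : Matrix (Fin 2) (Fin 2) (MvPowerSeries (Fin m) 𝒪 ⧸ pushoutTruncIdeal Θ u n)) 1 0 = 0) ∧
      (∀ σ, e σ ∈ kerParabolic (id : Fin 2 → Fin 2) (quHom 𝓡 Θ hΘ n u)) ∧
      X ∈ kerMatrix (quHom 𝓡 Θ hΘ n u) ∧
      ∀ σ, liftDiff ρv (NearlyOrdinaryDeformationRing.conjLocal P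
          ((Matrix.GeneralLinearGroup.map (quZeroInv 𝓡 Θ hΘ n u hu)).comp (𝓡.modPow n)) v) σ =
        e σ + (X - (s' (𝓡.localModPow v n σ) :
            Matrix (Fin 2) (Fin 2) (MvPowerSeries (Fin m) 𝒪 ⧸ pushoutTruncIdeal Θ u n)) * X *
          ((s' (𝓡.localModPow v n σ))⁻¹ : GL (Fin 2) (MvPowerSeries (Fin m) 𝒪 ⧸ pushoutTruncIdeal Θ u n))) := by
  refine ⟨Matrix.GeneralLinearGroup.map (quZeroInv 𝓡 Θ hΘ n u hu) (𝓡.noFrameModPow v n),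
    map_quHom_map_quZeroInv 𝓡 Θ hΘ n u hu _,
    Matrix.GeneralLinearGroup.map (quZeroInv 𝓡 Θ hΘ n u hu), map_quHom_map_quZeroInv 𝓡 Θ hΘ n u hu,
    (Matrix.GeneralLinearGroup.map (quZeroInv 𝓡 Θ hΘ n u hu)).comp (𝓡.localModPow v n), fun _ => 0, 0,
    map_quHom_comp_map_quZeroInv 𝓡 Θ hΘ n u hu _, fun σ => ?_, fun _ => zero_mem _, zero_mem _,
    fun σ => ?_⟩
  · -- upper triangular
    have h := (mem_parabolicGL_id_fin_two_iff _).mp (𝓡.localModPow_mem_borel v hv n σ)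
    change quZeroInv 𝓡 Θ hΘ n u hu ((𝓡.localModPow v n σ : Matrix (Fin 2) (Fin 2) _) 1 0) = 0
    rw [h, map_zero]
  · -- the difference cochain vanishes: `P⁻¹ ρ_B|_v P = ρ_v`
    have hconj : NearlyOrdinaryDeformationRing.conjLocal
        (Matrix.GeneralLinearGroup.map (quZeroInv 𝓡 Θ hΘ n u hu) (𝓡.noFrameModPow v n))
        ((Matrix.GeneralLinearGroup.map (quZeroInv 𝓡 Θ hΘ n u hu)).comp (𝓡.modPow n)) v σ =
        (Matrix.GeneralLinearGroup.map (quZeroInv 𝓡 Θ hΘ n u hu)).comp (𝓡.localModPow v n) σ := by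
      rw [NearlyOrdinaryDeformationRing.conjLocal_apply, MonoidHom.comp_apply, MonoidHom.comp_apply,
        𝓡.localModPow_eq_conj, map_mul, map_mul, map_inv, NearlyOrdinaryDeformationRing.modPow_apply]
    rw [liftDiff, hconj, mul_inv_cancel, Units.val_one, sub_self]
    simp

include hu in
/-- **Lifts over `B_0` (the degenerate functional)**: everything is transported along the
isomorphism `q_0⁻¹`, and the secondary difference cochain vanishes identically.
[cite: Bockle2007Presentations, Theorem 7.6] -/
theorem exists_coneLifts_zero :
    ∃ ρB : absoluteGaloisGroup F →* GL (Fin 2) (MvPowerSeries (Fin m) 𝒪 ⧸ pushoutTruncIdeal Θ u n),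
      (∀ σ, Matrix.GeneralLinearGroup.map (quHom 𝓡 Θ hΘ n u) (ρB σ) = 𝓡.modPow n σ) ∧
      IsOpen ((ρB.ker : Subgroup (absoluteGaloisGroup F)) : Set (absoluteGaloisGroup F)) ∧
      (∀ v ∉ 𝒟.S, Deformation.IsUnramifiedAt v ρB) ∧
      ∀ v : HeightOneSpectrum (𝓞 F), (p : 𝓞 F) ∈ v.asIdeal →
        ∃ (P : GL (Fin 2) (MvPowerSeries (Fin m) 𝒪 ⧸ pushoutTruncIdeal Θ u n))
          (_ : Matrix.GeneralLinearGroup.map (quHom 𝓡 Θ hΘ n u) P = 𝓡.noFrameModPow v n)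
          (s' : GL (Fin 2) (𝓡.R ⧸ maximalIdeal 𝓡.R ^ n) →
            GL (Fin 2) (MvPowerSeries (Fin m) 𝒪 ⧸ pushoutTruncIdeal Θ u n))
          (_ : ∀ g, Matrix.GeneralLinearGroup.map (quHom 𝓡 Θ hΘ n u) (s' g) = g)
          (ρv : absoluteGaloisGroup (v.adicCompletion F) →*
            GL (Fin 2) (MvPowerSeries (Fin m) 𝒪 ⧸ pushoutTruncIdeal Θ u n))
          (e : absoluteGaloisGroup (v.adicCompletion F) →
            Matrix (Fin 2) (Fin 2) (MvPowerSeries (Fin m) 𝒪 ⧸ pushoutTruncIdeal Θ u n))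
          (X : Matrix (Fin 2) (Fin 2) (MvPowerSeries (Fin m) 𝒪 ⧸ pushoutTruncIdeal Θ u n)),
          (∀ σ, Matrix.GeneralLinearGroup.map (quHom 𝓡 Θ hΘ n u) (ρv σ) = 𝓡.localModPow v n σ) ∧
          (∀ σ, (ρv σ : Matrix (Fin 2) (Fin 2) (MvPowerSeries (Fin m) 𝒪 ⧸ pushoutTruncIdeal Θ u n)) 1 0 = 0) ∧
          (∀ σ, e σ ∈ kerParabolic (id : Fin 2 → Fin 2) (quHom 𝓡 Θ hΘ n u)) ∧
          X ∈ kerMatrix (quHom 𝓡 Θ hΘ n u) ∧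
          ∀ σ, liftDiff ρv (NearlyOrdinaryDeformationRing.conjLocal P ρB v) σ =
            e σ + (X - (s' (𝓡.localModPow v n σ) :
                Matrix (Fin 2) (Fin 2) (MvPowerSeries (Fin m) 𝒪 ⧸ pushoutTruncIdeal Θ u n)) * X *
              ((s' (𝓡.localModPow v n σ))⁻¹ : GL (Fin 2) (MvPowerSeries (Fin m) 𝒪 ⧸ pushoutTruncIdeal Θ u n))) := by
  refine ⟨(Matrix.GeneralLinearGroup.map (quZeroInv 𝓡 Θ hΘ n u hu)).comp (𝓡.modPow n),
    map_quHom_comp_map_quZeroInv 𝓡 Θ hΘ n u hu _, ?_, fun v hv 𝔓 h𝔓 σ hσ => ?_,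
    fun v hv => exists_coneLocalLifts_zero 𝓡 Θ hΘ n u hu v hv⟩
  · rw [ker_comp_map_quZeroInv]
    exact 𝓡.isOpen_ker_modPow n
  · rw [MonoidHom.comp_apply, 𝓡.modPow_unramified n v hv 𝔓 h𝔓 σ hσ, map_one]

end Zero

/-! ## 2. `NearlyOrdinaryPresentation` from a bound on `dim ConeH2` -/

section ConeH2Of

variable {F : Type} [Field F] [NumberField F] {p : ℕ} {𝒪 : Type} [CommRing 𝒪] [IsLocalRing 𝒪]
  {k : Type} [Field k] [Algebra 𝒪 k] {𝒟 : NearlyOrdinaryDatum F p 𝒪 k}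
  (𝓡 : NearlyOrdinaryDeformationRing.{0} 𝒟)
  {m : ℕ} (Θ : MvPowerSeries (Fin m) 𝒪 →ₐ[𝒪] 𝓡.R) (hΘ : Function.Surjective Θ)
  (n : ℕ) (hn0 : n ≠ 0)

/-- **The cone `H²` attached to a presentation `Θ` and an exponent `n`** (coefficients
`κ = 𝒪⟦T⟧/𝔪`; as a `κ`-module it depends only on `ρ̄`, `S` and the places above `p`).
[cite: Bockle2007Presentations, Theorem 7.6] -/
abbrev ConeH2Of : Type :=
  ConeH2 (residualK 𝓡 Θ hΘ n hn0)
    (fun v : PlacesAbove F p => absoluteGaloisGroup (v.1.adicCompletion F)) (coneι 𝒟)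
    (fun v : PlacesAbove F p => localResidualK 𝓡 Θ hΘ n hn0 v.1) (id : Fin 2 → Fin 2)
    (coneFrame 𝓡 Θ hΘ n hn0)

end ConeH2Of

section Record

variable (F : Type) [Field F] [NumberField F] (p : ℕ) (𝒪 : Type) [CommRing 𝒪] [IsDomain 𝒪]
  [IsDiscreteValuationRing 𝒪] [IsAdicComplete (maximalIdeal 𝒪) 𝒪] (k : Type) [Field k]
  [Algebra 𝒪 k] (𝒟 : NearlyOrdinaryDatum F p 𝒪 k) (𝓡 : NearlyOrdinaryDeformationRing.{0} 𝒟)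

set_option quotPrecheck false in
/-- `h = dim_k t_{R_𝒟}` (local notation, as in `NearlyOrdinaryPresentationProofs`). -/
local notation "hR" => ((maximalIdeal (NearlyOrdinaryDeformationRing.R 𝓡)).map
  (Ideal.Quotient.mk ((maximalIdeal 𝒪).map
    (algebraMap 𝒪 (NearlyOrdinaryDeformationRing.R 𝓡))))).spanFinrank

set_option quotPrecheck false in
/-- `𝒪⟦T₁, …, T_h⟧` (local notation). -/
local notation "PR" => MvPowerSeries (Fin hR) 𝒪

/-- **`NearlyOrdinaryPresentation` for `𝓡` from a bound on the cone `H²`.**  If for every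
minimal cotangent presentation `Θ : 𝒪⟦T₁, …, T_h⟧ ↠ R_𝒟` and every `n ≥ 2` with
`J ∩ 𝔪ⁿ ⊆ 𝔪J` the cone cohomology `ConeH2Of 𝓡 Θ n` is finite-dimensional over `κ = 𝒪⟦T⟧/𝔪`
with `dim ConeH2Of + 1 + [F:ℚ] ≤ h`, then `R_𝒟 ≅ 𝒪⟦T₁, …, T_h⟧/(f₁, …, f_m)` with
`m + 1 + [F:ℚ] ≤ h` (the record `NearlyOrdinaryPresentation` for `𝓡`).  Proof: the cone
obstruction map `coneOb` is `κ`-linear (`ConeCochainOfFunctional`), its zeros split the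
pushed-out small extensions (`exists_coneLifts_of_isConeCoboundary`, `exists_coneLifts_zero`),
and `nearlyOrdinaryPresentation_of_lifts` (universality + Mazur's relation count + the regular
presentation) concludes. [cite: Bockle2007Presentations, Theorem 7.6]
[cite: Mazur1989Deforming, §1.6 Prop. 2] -/
theorem nearlyOrdinaryPresentation_of_coneH2
    (hcount : ∀ Θ : PR →ₐ[𝒪] 𝓡.R, (hΘ : Function.Surjective Θ) →
      RingHom.ker Θ ≤ maximalIdeal PR ^ 2 ⊔ (maximalIdeal 𝒪).map (algebraMap 𝒪 PR) →
      ∀ n : ℕ, (hn0 : n ≠ 0) → 2 ≤ n →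
        RingHom.ker Θ ⊓ maximalIdeal PR ^ n ≤ maximalIdeal PR * RingHom.ker Θ →
      Module.Finite (PR ⧸ maximalIdeal PR) (ConeH2Of 𝓡 Θ hΘ n hn0) ∧
        Module.finrank (PR ⧸ maximalIdeal PR) (ConeH2Of 𝓡 Θ hΘ n hn0) + 1 + Module.finrank ℚ F ≤ hR) :
    ∃ (A : Type) (_ : CommRing A) (_ : IsNoetherianRing A) (_ : IsLocalRing A)
      (_ : IsAdicComplete (maximalIdeal A) A) (_ : Algebra 𝒪 A) (n : ℕ)
      (_ : A ≃ₐ[𝒪] MvPowerSeries (Fin n) 𝒪) (rs : List A) (I : Ideal A) (_ : 𝓡.R ≃ₐ[𝒪] A ⧸ I),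
      Ideal.ofList rs = maximalIdeal A ∧ RingTheory.Sequence.IsRegular A rs ∧
        rs.length = n + 1 ∧ (rs.length : WithBot ℕ∞) = ringKrullDim A ∧
        I.spanFinrank + 1 + Module.finrank ℚ F ≤ n := by
  refine nearlyOrdinaryPresentation_of_lifts F p 𝒪 k 𝒟 𝓡 fun Θ hΘ hmin n hn0 hn hJn => ?_
  have h := hcount Θ hΘ hmin n hn0 hn hJn
  rcases h with ⟨hfin, hdim⟩
  refine ⟨ConeH2Of 𝓡 Θ hΘ n hn0, inferInstance, inferInstance, hfin, coneOb 𝓡 Θ hΘ n hn0 hJn,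
    fun u hu0 => ?_, hdim⟩
  by_cases hu : u = 0
  · exact exists_coneLifts_zero 𝓡 Θ hΘ n u hu
  · exact exists_coneLifts_of_isConeCoboundary 𝓡 Θ hΘ n hn0 u hJn hu
      ((coneOb_eq_zero_iff 𝓡 Θ hΘ n hn0 hJn u).mp hu0)

end Record

end NearlyOrdinaryPresentationCA

end Literature.NumberTheory.GaloisRepresentations
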